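import Summits.HodgeConjecture.HodgeConjecture.Theorems.PadicSemiregularLiftPadicPridhamSemiregularity
import Summits.HodgeConjecture.HodgeConjecture.Theorems.PadicSemiregularLiftFormalLiftingFromClassLiftingGlue
import HarnessLib

/-!
# `FormalLiftingFromClassLifting` (stmt-HodgeConjecture-13825) · the UNOBSTRUCTED corner, unconditionally

Crux P1a of route `HodgeConjecture/PadicSemiregularLift` asks that a finite locally free `E₁` on the special
fibre `X_k` of a Hodge-torsion-free smooth proper model `𝒳/W(k)` with hypothesis (⋆)
CLASS-LIFTS-IMPLY-OBJECT-LIFTS and a rational pro-class under `[E₁] ⊗ 1` lift formally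
(`WittScheme.LiftsFormally`). Its closure in rank `≥ 2` rests on X. Hu's infinitesimal `K₀`-lifting
criterion (named facts `KTheory.HuKZeroLiftingCriterion` / `HuKZeroKernelPresentation`, unproved).

This file lands the one corner of the crux that needs NO `K`-theory, NO class-lifting hypothesis and NO
torsion hypothesis: if the Illusie obstruction group `Ext²_{X_k}(E₁, E₁ ⊗ 𝒪)` of `E₁` vanishes
(`E₁` is *unobstructed*), then `E₁` lifts formally on every smooth proper model — Grothendieck's /
Illusie's "no obstruction ⇒ lift step by step" (SGA 1 III 7; Illusie, *Complexe cotangent* IV §3;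
FGA Explained Thm. 8.5.3 (b); the argument quoted from Česnavičius 2020 §2 in
`Literature/AlgebraicGeometry/Deformation/VectorBundleLifting`). The obstruction theory used is the REAL
one of the tree: the Čech-built Illusie obstruction `illusieObstructionAdditiveSep` (crux P1b,
stmt-HodgeConjecture-13815, `Theorems/PadicSemiregularLiftPadicPridhamSemiregularity`) across the
first-order thickenings `X_{n+1} ↪ X_{n+2}` of the `p`-adic tower (ideal `≅ 𝒪_{X_k}`,
`idealModule_thickeningMap`), and the climb is the landed reduction
`Glue.liftsFormally_of_stepClassLifting`.

* `exists_lift_step_of_subsingleton_obstructionGroup` — on a smooth proper model, every finite locally free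
  `F` on `X_{n+1}` with `F|X_k ≅ E₁` and `Ext²(E₁, E₁ ⊗ 𝒪) = 0` lifts to a finite locally free module on
  `X_{n+2}`;
* `liftsFormally_of_subsingleton_obstructionGroup` — hence such an `E₁` lifts formally;
* `formalLiftingFromClassLifting_of_subsingleton_obstructionGroup` — the crux's conclusion for
  unobstructed `E₁` under the crux's hypotheses (all but smoothness/properness unused), i.e. the
  registered sub-goal of stmt-HodgeConjecture-13825 this file serves.

Smooth proper is used only for: `X_{n+2}` separated, and flatness of `𝒳/W` in the identification of
the ideal of `X_{n+1} ↪ X_{n+2}` with `𝒪_{X_k}`.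
-/

noncomputable section

open CategoryTheory CategoryTheory.Abelian AlgebraicGeometry
open Literature.AlgebraicGeometry Literature.AlgebraicGeometry.Motives
  Literature.AlgebraicGeometry.Motives.WittScheme Literature.AlgebraicGeometry.Deformation
  Literature.AlgebraicGeometry.Modules

-- the mandated namespace `Summit.HodgeConjecture.HodgeConjecture.…` repeats a component
set_option linter.dupNamespace false

namespace Summit.HodgeConjecture.HodgeConjecture.Theorems.FormalLiftingFromClassLifting.Unobstructed

open Summit.HodgeConjecture.HodgeConjecture.Theorems.PadicPridhamSemiregularity
  (illusieObstructionAdditiveSep idealModule_thickeningMap stub_thickeningMap_firstOrder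
    stub_specialFibreToThickening_closedImmersion)
open Summit.HodgeConjecture.HodgeConjecture.Theorems.FormalLiftingFromClassLifting.Glue
  (liftsFormally_of_stepClassLifting)

variable {p : ℕ} [Fact p.Prime] {k : Type} [Field k] [CharP k p] [PerfectRing k p] {d : ℕ}
  {𝒳 : SchemeOver (WittVector p k)}

/-- **One unobstructed step.** On a smooth proper model `𝒳/W(k)`, a finite locally free `F` on
`X_{n+1}` whose restriction to `X_k` is isomorphic to an `E₁` with `Ext²_{X_k}(E₁, E₁ ⊗ 𝒪) = 0` lifts
to a finite locally free module on `X_{n+2}`: the Illusie obstruction `Ob(F) ∈ Ext²(j^*F, j^*F ⊗ 𝒪)`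
(`illusieObstructionAdditiveSep` across the first-order thickening `X_{n+1} ↪ X_{n+2}`, ideal
`≅ 𝒪_{X_k}`) lives in a group isomorphic (along `j^*F ≅ E₁`, `obstructionGroupCongr`) to the zero
group, so it vanishes, and (B) of the obstruction package gives the lift.
[cite: Illusie1971, IV Prop. 3.1.5] -/
theorem exists_lift_step_of_subsingleton_obstructionGroup (h𝒳 : IsSmoothProperModel d 𝒳)
    {E₁ : (specialFibre 𝒳).left.Modules}
    (hE : Subsingleton (obstructionGroup 2 E₁ (unitModule (specialFibre 𝒳).left)))
    (n : ℕ) (F : (thickening 𝒳 (n + 1)).left.Modules) (hF : IsFiniteLocallyFree F)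
    (e : (Scheme.Modules.pullback (specialFibreToThickening 𝒳 n)).obj F ≅ E₁) :
    ∃ F' : (thickening 𝒳 (n + 2)).left.Modules, IsFiniteLocallyFree F' ∧
      Nonempty ((Scheme.Modules.pullback (thickeningMap 𝒳 (Nat.le_succ (n + 1)))).obj F' ≅ F) := by
  haveI : IsFirstOrderThickening (thickeningMap 𝒳 (Nat.le_succ (n + 1))) :=
    stub_thickeningMap_firstOrder p k 𝒳 n
  haveI : IsClosedImmersion (specialFibreToThickening 𝒳 n) :=
    stub_specialFibreToThickening_closedImmersion p k 𝒳 n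
  -- `X_{n+2}` is separated: it is proper (base change of the proper `𝒳 → Spec W`) over an affine base
  haveI : IsSeparated (thickening 𝒳 (n + 2)).hom := by
    haveI : IsProper 𝒳.hom := h𝒳.isProper
    change IsSeparated (Limits.pullback.snd 𝒳.hom _)
    infer_instance
  haveI : (thickening 𝒳 (n + 2)).left.IsSeparated := by
    constructor
    rw [show Limits.terminal.from (thickening 𝒳 (n + 2)).left =
        (thickening 𝒳 (n + 2)).hom ≫ Limits.terminal.from _ from Limits.terminal.hom_ext _ _]
    infer_instance
  obtain ⟨eI⟩ := idealModule_thickeningMap p k d 𝒳 h𝒳 n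
  obtain ⟨Ob, hdet, -⟩ :=
    illusieObstructionAdditiveSep k (specialFibre 𝒳) (thickening 𝒳 (n + 1)).left
      (thickening 𝒳 (n + 2)).left (specialFibreToThickening 𝒳 n)
      (thickeningMap 𝒳 (Nat.le_succ (n + 1))) eI
  -- the obstruction group of `j^*F` is that of `E₁`, which is zero
  haveI : Subsingleton (obstructionGroup 2
      ((Scheme.Modules.pullback (specialFibreToThickening 𝒳 n)).obj F)
      (unitModule (specialFibre 𝒳).left)) :=
    (obstructionGroupCongr 2 e (unitModule (specialFibre 𝒳).left)).toEquiv.subsingleton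
  exact (hdet F hF).mp (Subsingleton.elim _ _)

/-- **Unobstructed bundles lift formally** (Grothendieck / Illusie: "no obstruction ⇒ lift step by
step, `𝒱̂ = lim 𝒱_n`"). On a smooth proper model `𝒳/W(k)` (`k` perfect of characteristic `p`), a
finite locally free `E₁` on the special fibre with `Ext²_{X_k}(E₁, E₁ ⊗ 𝒪) = 0` lifts to a compatible
system of vector bundles on all the thickenings `X_{n+1} = 𝒳 ⊗ W/p^{n+1}` (`WittScheme.LiftsFormally`):
the climb `Glue.liftsFormally_of_stepClassLifting` fed, at every level, with the unobstructed step
(its class-lifting premise being supplied by the class of the lift itself).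
[cite: Illusie1971, IV Prop. 3.1.5] [cite: Cesnavicius2020GLVectorBundles, §2] -/
theorem liftsFormally_of_subsingleton_obstructionGroup (h𝒳 : IsSmoothProperModel d 𝒳)
    {E₁ : (specialFibre 𝒳).left.Modules} (hE₁ : IsFiniteLocallyFree E₁)
    (hE : Subsingleton (obstructionGroup 2 E₁ (unitModule (specialFibre 𝒳).left))) :
    LiftsFormally 𝒳 E₁ := by
  have hlift : ∀ (n : ℕ) (F : (thickening 𝒳 (n + 1)).left.Modules) (hF : IsFiniteLocallyFree F),
      Nonempty ((Scheme.Modules.pullback (specialFibreToThickening 𝒳 n)).obj F ≅ E₁) →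
      ∃ F' : (thickening 𝒳 (n + 2)).left.Modules, IsFiniteLocallyFree F' ∧
        Nonempty ((Scheme.Modules.pullback (thickeningMap 𝒳 (Nat.le_succ (n + 1)))).obj F' ≅ F) :=
    fun n F hF ⟨e⟩ => exists_lift_step_of_subsingleton_obstructionGroup h𝒳 hE n F hF e
  refine liftsFormally_of_stepClassLifting hE₁ (fun n F hF h _ => hlift n F hF h) fun n F hF h => ?_
  obtain ⟨F', hF', ⟨φ⟩⟩ := hlift n F hF h
  exact ⟨KTheory.KZero.of F' hF', by
    rw [KTheory.KZero.map_of]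
    exact KTheory.KZero.of_iso φ _ hF⟩

/-- **The unobstructed corner of the crux `FormalLiftingFromClassLifting`** (stmt-HodgeConjecture-13825),
unconditionally: under the crux's hypotheses, every finite locally free `E₁` on `X_k` with
`Ext²_{X_k}(E₁, E₁ ⊗ 𝒪) = 0` lifts formally — hypothesis (⋆), the rational pro-class, projectivity,
`d + 6 < p` and torsion-freeness are not needed in this corner. [cite: Illusie1971, IV Prop. 3.1.5] -/
theorem formalLiftingFromClassLifting_of_subsingleton_obstructionGroup :
    ∀ (p : ℕ) [Fact p.Prime] (k : Type) [Field k] [CharP k p] [PerfectRing k p] (d : ℕ)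
      (𝒳 : SchemeOver (WittVector p k)), IsSmoothProperModel d 𝒳 →
      Literature.AlgebraicGeometry.Crystalline.IsProjectiveOverRing 𝒳 → d + 6 < p →
      (∀ (b : ℕ) (x : structureSheafCohomology 𝒳.left b), (p : ℤ) • x = 0 → x = 0) →
      (∀ (b : ℕ) (x : hodgeCohomologyOne 𝒳 b), (p : ℤ) • x = 0 → x = 0) →
      (d ≤ 3 ∨ Nonempty (cotangentSheaf 𝒳 ≅ SheafOfModules.free (R := 𝒳.left.ringCatSheaf) (Fin d))) →
      ∀ (E₁ : (specialFibre 𝒳).left.Modules) (hE₁ : IsFiniteLocallyFree E₁),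
        Subsingleton (obstructionGroup 2 E₁ (unitModule (specialFibre 𝒳).left)) →
        (∀ (n : ℕ) (F : (thickening 𝒳 (n + 1)).left.Modules) (hF : IsFiniteLocallyFree F),
          Nonempty ((Scheme.Modules.pullback (specialFibreToThickening 𝒳 n)).obj F ≅ E₁) →
          (∃ y : KTheory.KZero (thickening 𝒳 (n + 2)).left,
            KTheory.KZero.map (thickeningMap 𝒳 (Nat.le_succ (n + 1))) y = KTheory.KZero.of F hF) →
          ∃ F' : (thickening 𝒳 (n + 2)).left.Modules, IsFiniteLocallyFree F' ∧
            Nonempty ((Scheme.Modules.pullback (thickeningMap 𝒳 (Nat.le_succ (n + 1)))).obj F' ≅ F)) →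
        (∃ ξ : KTheory.ContinuousKZeroRat (Ideal.span {(p : WittVector p k)}) 𝒳,
          KTheory.KZeroRat.map (Literature.AlgebraicGeometry.Crystalline.specialFibreToTower 𝒳)
            (KTheory.ContinuousKZeroRat.specialFibre (Ideal.span {(p : WittVector p k)}) 𝒳 ξ) =
            KTheory.KZeroRat.of E₁ hE₁) →
        LiftsFormally 𝒳 E₁ :=
  fun _p _ _k _ _ _ _d _𝒳 h𝒳 _ _ _ _ _ _E₁ hE₁ hE _ _ =>
    liftsFormally_of_subsingleton_obstructionGroup h𝒳 hE₁ hE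

end Summit.HodgeConjecture.HodgeConjecture.Theorems.FormalLiftingFromClassLifting.Unobstructed

end
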